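import Literature.AlgebraicGeometry.Motives.JacobianAbelSumFibres
import HarnessLib

/-!
# The dense open of Step I for an ABSTRACT Jacobian, from Weil's model: general points of `J` are `g`-fold Abel sums of
# `g` DISTINCT points, unique up to order (Milne, *Jacobian Varieties*, §5 Thm. 5.1 (a), §6 Lemma 6.7; Lange 2023, Lemma 4.4.4 Step I)

Layer `Literature/AlgebraicGeometry/Motives`, namespace `Literature.AlgebraicGeometry.Motives.Jacobian`.
KERNEL ONLY: theorems; no definition, no named fact, no instance, no `sorry`.

A-p03 (g13)'s ★ `Motives/WeilJacobianStepOneOpen` proves the statement on WEIL'S MODEL `Jac` (★ `WeilJacobian.exists_opens_general_sum`: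
a non-empty open `U ⊆ Jac` over whose `K`-points every `a` is `∏ⱼ f(τⱼ)` for `g` DISTINCT points `τⱼ`, unique up to permutation).  This file
TRANSPORTS it to an arbitrary Jacobian `𝒥 : Jacobian C` (universal property, `Motives/Jacobian`) and an arbitrary base point `P`, in the
(W)-road form of ★ `Motives/JacobianAbelTheoremOfWeilModel` (A-p02 (g15)): GIVEN a homomorphism `v : Jac → 𝒥.J` with `f_J ≫ v = α_{R₀(j₀)}`
(supplied by the sibling leaf (W1) «Weil's `(Jac, f_J)` has the universal property», then `v = Jacobian.uniqueUpToIso`):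

* `descPointed_comp_eq_id` / `comp_descPointed_eq_id` — the Albanese factorisation `u : 𝒥.J → Jac` of `f_J` (★ `descPointed`, `α_{R₀} ≫ u = f_J`)
  and `v` are MUTUALLY INVERSE (`u ≫ v = 𝟙` by ★ `hom_ext_abelJacobi`; `v ≫ u = 𝟙` by ★ `Generates.hom_ext` for the generating `f_J`,
  ★ `generates_fJ`) — so under (W1) `u` is an isomorphism;
* **`exists_opens_general_abelSum_of_weilModel`** — the socket **`hopen`** of ★ A-p02 (g15)'s `Motives/JacobianStepOneOfLeaves`
  (`exists_open_ajSum_classPullback_shear_of_leaves`) at `r + 1 = g`, VERBATIM: a non-empty open `U₁ ⊆ 𝒥.J` such that every `a ∈ J(K)` with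
  `a.pt ∈ U₁` is `∏ⱼ α_P(τⱼ)` for an INJECTIVE `τ : Fin g → C(K)`, and every `τ′` with the same Abel sum is `τ ∘ σ` — transported along `u`
  (`U₁ := (t_{e⁻¹} ≫ u)⁻¹ U`, `e := (α_{R₀}(P)⁻¹)^g` the base-point constant of ★ `prod_comp_abelJacobi_eq_mul_pow`).

Cell `hodgecm-mathlib` (D-0151), crux HLiu418 = stmt-HodgeConjecture-24832, road G4 / (E), socket (i) `hopen` of the architect's 08:40:07Z list.
COUNT-NEUTRAL capital; HC_CM is proved only modulo the 7 printed citations until rung 0 closes.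

## References
* [Milne1986JacobianVarieties] J. S. Milne, *Jacobian Varieties* (1986), §5 Thm. 5.1 (a) (`f^{(g)}` is birational, injective on `ℓ = 1`),
  §6 Prop. 6.1 (universal property of `f^P`), §6 Lemma 6.7 (the open `U`), §7 Thm. 7.1 (Weil's construction generates).
* [Lange2023AbelianVarietiesComplex] H. Lange, *Abelian Varieties over the Complex Numbers* (2023), §4.4.2 Lemma 4.4.4, Step I (for general
  `x`, `g` pairwise different points with `h⁰ = 1`); §4.1.3 (base point).
-/

set_option autoImplicit false

noncomputable section

universe u

open CategoryTheory CategoryTheory.Limits AlgebraicGeometry MonoidalCategory CartesianMonoidalCategory MonObj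
open Literature.NumberTheory.DiophantineGeometry
open Literature.NumberTheory.DiophantineGeometry.AlgFunctionField
open Literature.AlgebraicGeometry.RelativeSpec

namespace Literature.AlgebraicGeometry.Motives

open RatFn FieldPoint CartierDivisor CurvePlaces WeilJacobian

namespace Jacobian

variable {K : Type u} [Field K] [IsAlgClosed K] [CharZero K]
  {C : SchemeOver K} [IsIntegral C.left] [SmoothOfRelativeDimension 1 C.hom] [IsProper C.hom]
  [GeometricallyIntegral C.hom] (hC : IsProjectiveOver C) (hX : CechPseudoCoherentAt C) (g : ℕ)
  (hg : (genus K (curveBC C (strPt (K := K) K)).left.functionField : ℤ) ≤ g)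
  (hW : (chartW C g hC).Nonempty) (j₀ : Fin g) (𝒥 : Jacobian C)

/-! ## §1 Under (W1) the Albanese factorisation `u : 𝒥.J → Jac` is an isomorphism with inverse `v` -/

/-- `u ≫ v = 𝟙`: both `𝟙` and `u ≫ v` take `α_{R₀}` to `α_{R₀}` (`α_{R₀} ≫ u = f_J`, `f_J ≫ v = α_{R₀}`), and homomorphisms out of a Jacobian
are determined by their composite with the Abel–Jacobi map (★ `hom_ext_abelJacobi`, Milne Prop. 6.1 uniqueness).
[cite: Milne1986JacobianVarieties, §6 Prop. 6.1] -/
theorem descPointed_comp_eq_id (v : Jac C hC hX g hg hW ⟶ 𝒥.J)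
    (hv : fJ C hC hX g hg hW j₀ ≫ v.hom.hom.hom = 𝒥.abelJacobi (baseTuple C hC hX g hW j₀)) :
    𝒥.descPointed (baseTuple C hC hX g hW j₀) (fJ C hC hX g hg hW j₀) (baseTuple_comp_fJ C hC hX g hg hW j₀) ≫ v = 𝟙 𝒥.J := by
  apply 𝒥.hom_ext_abelJacobi (baseTuple C hC hX g hW j₀)
  have h1 : 𝒥.abelJacobi (baseTuple C hC hX g hW j₀) ≫ (𝒥.descPointed (baseTuple C hC hX g hW j₀) (fJ C hC hX g hg hW j₀)
      (baseTuple_comp_fJ C hC hX g hg hW j₀) ≫ v).hom.hom.hom =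
      (𝒥.abelJacobi (baseTuple C hC hX g hW j₀) ≫ (𝒥.descPointed (baseTuple C hC hX g hW j₀) (fJ C hC hX g hg hW j₀)
        (baseTuple_comp_fJ C hC hX g hg hW j₀)).hom.hom.hom) ≫ v.hom.hom.hom := by
    rw [Category.assoc]; rfl
  rw [h1, 𝒥.abelJacobi_descPointed, hv]
  exact (Category.comp_id _).symm

/-- `v ≫ u = 𝟙`: both take `f_J` to `f_J`, and `f_J` GENERATES Weil's Jacobian (★ `generates_fJ`, ★ `Generates.hom_ext`; Milne §7).
[cite: Milne1986JacobianVarieties, §7 Thm. 7.1 and §6 Prop. 6.1] -/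
theorem comp_descPointed_eq_id {n : ℕ} (hn : g = n + 1) (v : Jac C hC hX g hg hW ⟶ 𝒥.J)
    (hv : fJ C hC hX g hg hW j₀ ≫ v.hom.hom.hom = 𝒥.abelJacobi (baseTuple C hC hX g hW j₀)) :
    v ≫ 𝒥.descPointed (baseTuple C hC hX g hW j₀) (fJ C hC hX g hg hW j₀) (baseTuple_comp_fJ C hC hX g hg hW j₀) =
      𝟙 (Jac C hC hX g hg hW) := by
  apply (generates_fJ C hC hX g hg hW j₀ hn).hom_ext
  have h1 : fJ C hC hX g hg hW j₀ ≫ (v ≫ 𝒥.descPointed (baseTuple C hC hX g hW j₀) (fJ C hC hX g hg hW j₀)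
      (baseTuple_comp_fJ C hC hX g hg hW j₀)).hom.hom.hom =
      (fJ C hC hX g hg hW j₀ ≫ v.hom.hom.hom) ≫ (𝒥.descPointed (baseTuple C hC hX g hW j₀) (fJ C hC hX g hg hW j₀)
        (baseTuple_comp_fJ C hC hX g hg hW j₀)).hom.hom.hom := by
    rw [Category.assoc]; rfl
  rw [h1, hv, 𝒥.abelJacobi_descPointed]
  exact (Category.comp_id _).symm

/-- Under (W1), `u` is injective on `K`-points (it has the left inverse `v`). [cite: Milne1986JacobianVarieties, §6 Prop. 6.1] -/
theorem comp_descPointed_injective (v : Jac C hC hX g hg hW ⟶ 𝒥.J)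
    (hv : fJ C hC hX g hg hW j₀ ≫ v.hom.hom.hom = 𝒥.abelJacobi (baseTuple C hC hX g hW j₀)) :
    Function.Injective fun a : 𝒥.J.Points K =>
      a ≫ (𝒥.descPointed (baseTuple C hC hX g hW j₀) (fJ C hC hX g hg hW j₀) (baseTuple_comp_fJ C hC hX g hg hW j₀)).hom.hom.hom := by
  intro a a' h
  have h' := congrArg (fun b => b ≫ v.hom.hom.hom) h
  simp only [Category.assoc] at h'
  have huv := congrArg (fun w => w.hom.hom.hom) (𝒥.descPointed_comp_eq_id hC hX g hg hW j₀ v hv)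
  change (𝒥.descPointed _ _ _).hom.hom.hom ≫ v.hom.hom.hom = 𝟙 _ at huv
  rwa [huv, Category.comp_id, Category.comp_id] at h'

/-- Under (W1), the underlying scheme morphism of `u` is an isomorphism (with inverse that of `v`).
[cite: Milne1986JacobianVarieties, §6 Prop. 6.1 and §7 Thm. 7.1] -/
theorem isIso_descPointed_left {n : ℕ} (hn : g = n + 1) (v : Jac C hC hX g hg hW ⟶ 𝒥.J)
    (hv : fJ C hC hX g hg hW j₀ ≫ v.hom.hom.hom = 𝒥.abelJacobi (baseTuple C hC hX g hW j₀)) :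
    IsIso (𝒥.descPointed (baseTuple C hC hX g hW j₀) (fJ C hC hX g hg hW j₀)
      (baseTuple_comp_fJ C hC hX g hg hW j₀)).hom.hom.hom.left := by
  refine ⟨v.hom.hom.hom.left, ?_, ?_⟩
  · have h := congrArg (fun w => w.hom.hom.hom.left) (𝒥.descPointed_comp_eq_id hC hX g hg hW j₀ v hv)
    exact h
  · have h := congrArg (fun w => w.hom.hom.hom.left) (𝒥.comp_descPointed_eq_id hC hX g hg hW j₀ hn v hv)
    exact h

/-! ## §2 The socket `hopen` of `JacobianStepOneOfLeaves`, from Weil's model -/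

/-- **`hopen` for an ABSTRACT Jacobian, from Weil's model (W)**: for a smooth projective curve `C` over an algebraically closed field of
characteristic `0`, Weil's auxiliary data, ANY Jacobian `𝒥` of `C`, a homomorphism `v : Jac → 𝒥.J` with `f_J ≫ v = α_{R₀(j₀)}` ((W1)), and any
base point `P ∈ C(K)`: there is a non-empty open `U₁ ⊆ J` such that every `a ∈ J(K)` with `a.pt ∈ U₁` is the Abel sum `∏ⱼ α_P(τⱼ)` of `g`
DISTINCT points `τⱼ ∈ C(K)`, and any `τ′` with the same Abel sum is a permutation of `τ` — ★ `WeilJacobian.exists_opens_general_sum`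
transported along the isomorphism `u = v⁻¹` (§1) and re-based at `P` (★ `prod_comp_abelJacobi_eq_mul_pow`).  This is the hypothesis `hopen` of
★ `Jacobian.exists_open_ajSum_classPullback_shear_of_leaves` (`Motives/JacobianStepOneOfLeaves`) at `r + 1 = g`, verbatim.
[cite: Milne1986JacobianVarieties, §5 Thm. 5.1 (a), §6 Prop. 6.1 and Lemma 6.7, §7 Thm. 7.1]
[cite: Lange2023AbelianVarietiesComplex, §4.4.2 Lemma 4.4.4 (Step I) and §4.1.3] -/
theorem exists_opens_general_abelSum_of_weilModel {n : ℕ} (hn : g = n + 1) (v : Jac C hC hX g hg hW ⟶ 𝒥.J)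
    (hv : fJ C hC hX g hg hW j₀ ≫ v.hom.hom.hom = 𝒥.abelJacobi (baseTuple C hC hX g hW j₀)) (P : AlgPoints C K) :
    ∃ U₁ : 𝒥.J.X.left.Opens, (U₁ : Set 𝒥.J.X.left).Nonempty ∧
      ∀ a : 𝒥.J.Points K, a.pt ∈ U₁ →
        ∃ τ : Fin g → AlgPoints C K, Function.Injective τ ∧ (∏ j, τ j ≫ 𝒥.abelJacobi P) = a ∧
          ∀ τ' : Fin g → AlgPoints C K, (∏ j, τ' j ≫ 𝒥.abelJacobi P) = a →
            ∃ σ : Equiv.Perm (Fin g), τ' = τ ∘ σ := by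
  set R := baseTuple C hC hX g hW j₀ with hR
  have hfR : R ≫ fJ C hC hX g hg hW j₀ = 1 := baseTuple_comp_fJ C hC hX g hg hW j₀
  set u := 𝒥.descPointed R (fJ C hC hX g hg hW j₀) hfR with hu_def
  have hu : 𝒥.abelJacobi R ≫ u.hom.hom.hom = fJ C hC hX g hg hW j₀ := 𝒥.abelJacobi_descPointed R _ hfR
  have hinj := 𝒥.comp_descPointed_injective hC hX g hg hW j₀ v hv
  haveI := 𝒥.isIso_descPointed_left hC hX g hg hW j₀ hn v hv
  -- Weil's open and the base-point constant `e := (α_R(P)⁻¹)^g`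
  obtain ⟨U, hU, hgen⟩ := exists_opens_general_sum C hC hX g hg hW j₀
  set e : 𝒥.J.Points K := ((P ≫ 𝒥.abelJacobi R)⁻¹) ^ g with he
  -- `U₁ := (t_{e⁻¹} ≫ u)⁻¹ U`
  set φ : 𝒥.J.X.left ⟶ (Jac C hC hX g hg hW).X.left := (𝒥.J.translation e⁻¹).left ≫ u.hom.hom.hom.left with hφ
  refine ⟨φ ⁻¹ᵁ U, ?_, fun a ha => ?_⟩
  · obtain ⟨p, hp⟩ := hU
    haveI : IsIso φ := by rw [hφ]; infer_instance
    obtain ⟨q, rfl⟩ := (Scheme.homeoOfIso (asIso φ)).surjective p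
    exact ⟨q, hp⟩
  · -- the point `b := u(e⁻¹ a)` of Weil's Jacobian lies over `U`
    set b : specOver K K ⟶ (Jac C hC hX g hg hW).X := (e⁻¹ * a) ≫ u.hom.hom.hom with hb
    have hbpt : AlgPoints.pt b = φ.base a.pt := by
      rw [hφ, Scheme.Hom.comp_base, TopCat.coe_comp, Function.comp_apply]
      change AlgPoints.pt b = u.hom.hom.hom.left ((𝒥.J.translation e⁻¹).left (AlgPoints.pt a))
      rw [AbelianVariety.translation_apply_pt]
      rfl
    have hbU : AlgPoints.pt b ∈ U := by rw [hbpt]; exact ha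
    obtain ⟨τ, hτinj, hτ, huniq⟩ := hgen b hbU
    -- dictionary: `∏ⱼ α_P(τⱼ) = a  ↔  ∏ⱼ f_J(τⱼ) = b`
    have hdict : ∀ τ₁ : Fin g → AlgPoints C K,
        (∏ j, τ₁ j ≫ 𝒥.abelJacobi P) = a ↔ (∏ j, τ₁ j ≫ fJ C hC hX g hg hW j₀) = b := by
      intro τ₁
      have h1 : (∏ j, τ₁ j ≫ 𝒥.abelJacobi P) = a ↔ (∏ j, τ₁ j ≫ 𝒥.abelJacobi R) = e⁻¹ * a := by
        rw [𝒥.prod_comp_abelJacobi_eq_mul_pow R P τ₁, ← he]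
        constructor
        · intro h; rw [← h, mul_comm _ e, ← _root_.mul_assoc, inv_mul_cancel, _root_.one_mul]
        · intro h; rw [h, mul_comm e⁻¹ a, _root_.mul_assoc, inv_mul_cancel, _root_.mul_one]
      have h2 : (∏ j, τ₁ j ≫ 𝒥.abelJacobi R) = e⁻¹ * a ↔ (∏ j, τ₁ j ≫ fJ C hC hX g hg hW j₀) = b := by
        constructor
        · intro h
          rw [hb, ← h, prod_comp_hom]
          simp only [Category.assoc, hu]
        · intro h
          apply hinj
          change (∏ j, τ₁ j ≫ 𝒥.abelJacobi R) ≫ u.hom.hom.hom = (e⁻¹ * a) ≫ u.hom.hom.hom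
          rw [prod_comp_hom]
          simp only [Category.assoc, hu]
          rw [h]
      exact h1.trans h2
    exact ⟨τ, hτinj, (hdict τ).mpr hτ, fun τ' hτ' => huniq τ' ((hdict τ').mp hτ')⟩

/-- **The same with Weil's auxiliary data discharged** (as in ★ `curveGenus_le_jacobian_dim`): for a smooth projective curve of genus
`g ≥ 1` over an algebraically closed field of characteristic `0`, any Jacobian `𝒥`, any base point `P`, and any hypothesis-provider
`hv` producing the (W1) homomorphism for the Weil data at hand.  Stated with Weil's data explicit because `v` refers to them; the glue
instantiates `g := curveGenus C`. [cite: Milne1986JacobianVarieties, §6 Lemma 6.7 and §7 Thm. 7.1] -/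
theorem exists_opens_general_abelSum_of_weilModel' {n : ℕ} (hn : g = n + 1)
    (hv : ∃ v : Jac C hC hX g hg hW ⟶ 𝒥.J, fJ C hC hX g hg hW j₀ ≫ v.hom.hom.hom = 𝒥.abelJacobi (baseTuple C hC hX g hW j₀))
    (P : AlgPoints C K) :
    ∃ U₁ : 𝒥.J.X.left.Opens, (U₁ : Set 𝒥.J.X.left).Nonempty ∧
      ∀ a : 𝒥.J.Points K, a.pt ∈ U₁ →
        ∃ τ : Fin g → AlgPoints C K, Function.Injective τ ∧ (∏ j, τ j ≫ 𝒥.abelJacobi P) = a ∧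
          ∀ τ' : Fin g → AlgPoints C K, (∏ j, τ' j ≫ 𝒥.abelJacobi P) = a →
            ∃ σ : Equiv.Perm (Fin g), τ' = τ ∘ σ := by
  obtain ⟨v, hv⟩ := hv
  exact 𝒥.exists_opens_general_abelSum_of_weilModel hC hX g hg hW j₀ hn v hv P

end Jacobian

end Literature.AlgebraicGeometry.Motives

end
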